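import Summits.Langlands.Langlands.Theses.PrimitiveRankLadder

/-!
# Glue of the layer-2 re-split of `SatakeAvatarExistence` (route PrimitiveRankLadder, lens-1-g11 ⊕ g10)

Closes the glue item of `route-Langlands-PrimitiveRankLadder` generated by
`--resplit SatakeAvatarExistence --glue-decl-name SatakeAvatarExistence_of_split4`:
`SatakeAvatarExistence_of_split4 :
  SpreadInducedAvatar → QuadraticTwistDescent → HigherInverseInduction → HullTransport → WeaklyRegularHullAvatars →
    DegeneratePrimitiveAvatars → CuspidalAvatarIrreducible → SatakeAvatarExistence`.
Pure logic; two excluded middles.  (1) «the datum `π.1` lies in the regular-induction hull HULL₁» (the impredicative least class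
inlined, negated, in `WeaklyRegularHullAvatars`): instantiate leastness at the class «cuspidal L-algebraic data of positive rank
having a SEMISIMPLE Satake–Frobenius avatar for every (ℓ, ι)» — it contains rung 1 (the dial hands a totally-real-or-CM `K₀` with
`K/K₀` cyclic and an induced-REGULAR type `T`; SPRAI applied to EVERY cuspidal L-algebraic `π'` of type `T` is the twist family;
one `by_cases` on the box `n = 2 ∧ [K:K₀] = 2` routes it to Q (`subst n`) or H, which descend the avatar to `π`), and it is closed
under (up) by the first conjunct of TRN (= RTT 29150) and under (ai) by the second (= AIT 29151); IRR makes the avatar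
irreducible.  (2) Off HULL₁, «`π.1` lies in the weakly-regular-induction hull HULL₂» (inlined in both WHS and REST₃): on the belt
WHS hands a semisimple avatar and IRR upgrades it; off HULL₂, REST₃ is W⁺ verbatim.  This is the lens-1-g11 node proof
`WeaklyRegularInductionLadder.satakeAvatarExistence_of_split4` (decomp-langlands, 2026-08-30; certified against the gate render in
kit_check.lean and fullrender_probe.lean, rc 0), over the tree's declarations.  No definitions, no new mathematics.
-/

set_option linter.dupNamespace false -- project-wide option; `Summit.Langlands.Langlands` is the mandated namespace

namespace Summit.Langlands.Langlands.Theorems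

open scoped Classical
open Filter

/-- The glue item of the re-split of `PrimitiveRankLadder.SatakeAvatarExistence` (stmt-Langlands-17415): SPRAI (twist family over
the TR/CM base), Q / H (inverse induction on / off the box (2,2)), TRN (the two print transports saturating the hulls), WHS (the
weakly-regular belt), REST₃ (off the weakly-regular hull) and IRR imply W⁺. -/
theorem SatakeAvatarExistence_of_split4_proof :
    Summit.Langlands.Langlands.Theses.PrimitiveRankLadder.SatakeAvatarExistence_of_split4 := by
  intro hS hQ hH hT hW hR hI K _ _ n hcpt hn π hL ℓ _ ι
  by_cases hh : ∀ S : (∀ (K : Type) [Field K] [NumberField K] (n : ℕ) (hcpt : Literature.NumberTheory.Automorphic.isCompact_glFiniteIntegralLevel n K), Literature.NumberTheory.Automorphic.AutomorphicRepData (Literature.NumberTheory.Automorphic.AutomorphyDatum.gl n K hcpt) → Prop), ((∀ (K : Type) [Field K] [NumberField K] (n : ℕ) (hcpt : Literature.NumberTheory.Automorphic.isCompact_glFiniteIntegralLevel n K) (π : Literature.NumberTheory.Automorphic.CuspidalAutomorphicRepData n K hcpt), 0 < n → π.1.IsLAlgebraic → (∃ (K₀ : Type) (_ : Field K₀) (_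 : NumberField K₀) (_ : Algebra K₀ K), IsGalois K₀ K ∧ IsCyclic (K ≃ₐ[K₀] K) ∧ (NumberField.IsTotallyReal K₀ ∨ NumberField.IsCMField K₀) ∧ ∃ T : Literature.NumberTheory.Automorphic.InfinityType K n, π.1.HasInfinityType T ∧ (Literature.NumberTheory.Automorphic.InfinityType.automorphicInduction K₀ (n * Module.finrank K₀ K) T).IsRegular) → S K n hcpt π.1) ∧ (∀ (K₀ : Type) [Field K₀] [NumberField K₀] (M : Type) [Field M] [NumberField M] [Algebra K₀ M] (n : ℕ) (h₀ : Literature.NumberTheory.Automorphic.isCompact_glFiniteIntegralLevel n K₀) (hM : Literature.NumberTheory.Automorphic.isCompact_glFiniteIntegralLevel n M) (h₁ : Literature.NumberTheory.Automorphic.isCompact_glFiniteIntegralLevel 1 M) (π₀ : Literature.NumberTheory.Automorphic.CuspidalAutomorphicRepData n K₀ h₀) (χ : Literature.NumberTheory.Automorphic.AutomorphicRepData (Literature.NumberTheory.Automorphic.AutomorphyDatum.gl 1 M h₁)) (P : Literature.NumberTheory.Automorphic.AutomorphicRepData (Literature.NumberTheory.Automorphic.AutomorphyDatum.gl n M hM)),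 π₀.1.IsLAlgebraic → χ.IsLAlgebraic → (∀ᶠ w : IsDedekindDomain.HeightOneSpectrum (NumberField.RingOfIntegers M) in cofinite, ∀ (u : IsDedekindDomain.HeightOneSpectrum (NumberField.RingOfIntegers K₀)) (α : Multiset ℂ) (c : ℂ), w.asIdeal.under (NumberField.RingOfIntegers K₀) = u.asIdeal → π₀.1.HasSatakeParamAt u α → χ.HasSatakeParamAt w {c} → P.HasSatakeParamAt w ((α.map (· ^ w.asIdeal.inertiaDeg (NumberField.RingOfIntegers K₀))).map (c * ·))) → S K₀ n h₀ π₀.1 → S M n hM P) ∧ (∀ (K : Type) [Field K] [NumberField K] (L : Type) [Field L] [NumberField L] [Algebra K L] (m n : ℕ) (hL : Literature.NumberTheory.Automorphic.isCompact_glFiniteIntegralLevel m L) (hcpt : Literature.NumberTheory.Automorphic.isCompact_glFiniteIntegralLevel n K) (σ : Literature.NumberTheory.Automorphic.CuspidalAutomorphicRepData m L hL) (π : Literature.NumberTheory.Automorphic.AutomorphicRepData (Literature.NumberTheory.Automorphic.AutomorphyDatum.gl n K hcpt)), 0 < m → σ.1.IsLAlgebraic → (∀ᶠ v : IsDedekindDomain.HeightOneSpectrum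 (NumberField.RingOfIntegers K) in cofinite, ∀ β : IsDedekindDomain.HeightOneSpectrum (NumberField.RingOfIntegers L) → Multiset ℂ, (∀ w : IsDedekindDomain.HeightOneSpectrum (NumberField.RingOfIntegers L), w.asIdeal.under (NumberField.RingOfIntegers K) = v.asIdeal → σ.1.HasSatakeParamAt w (β w)) → ∃ α : Multiset ℂ, π.HasSatakeParamAt v α ∧ Literature.NumberTheory.Automorphic.satakePolynomial α = ∏ᶠ w ∈ {w : IsDedekindDomain.HeightOneSpectrum (NumberField.RingOfIntegers L) | w.asIdeal.under (NumberField.RingOfIntegers K) = v.asIdeal}, (Literature.NumberTheory.Automorphic.satakePolynomial (β w)).comp (Polynomial.X ^ w.asIdeal.inertiaDeg (NumberField.RingOfIntegers K))) → S L m hL σ.1 → S K n hcpt π)) → S K n hcpt π.1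
  · -- π.1 is in the regular-induction hull HULL₁: semisimple avatar by LEASTNESS of HULL₁, then IRR (g10 kernel; TRN = RTT ∧ AIT)
    obtain ⟨hRt, hA⟩ := hT
    have key := hh
      (fun K _ _ n hcpt P => 0 < n → P.W ≤ Literature.NumberTheory.Automorphic.cuspFormsGL n K hcpt → P.IsLAlgebraic → ∀ (ℓ : ℕ) [Fact ℓ.Prime] (ι : PadicAlgCl ℓ ≃+* ℂ), ∃ ρ : Literature.NumberTheory.GaloisRepresentations.FramedGaloisRep K (PadicAlgCl ℓ) n, ρ.toGaloisRep.IsSemisimple ∧ ∀ᶠ v : IsDedekindDomain.HeightOneSpectrum (NumberField.RingOfIntegers K) in Filter.cofinite, SatakeFrobCompatibleAt ι P ρ v)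
      ⟨?_, ?_, ?_⟩
    · obtain ⟨ρ, hss, hc⟩ := key hn π.2 hL ℓ ι
      exact ⟨ρ, hI K n hcpt hn π hL ℓ ι ρ hss hc, hc⟩
    · -- (r0) rung 1: SPRAI over the whole type-T family IS the twist family; Q (box (2,2)) or H (complement) descends it to π
      intro K _ _ n hcpt π hn hL hd _ _ _ ℓ _ ι
      obtain ⟨K₀, _, _, _, hG, hcyc, hK₀, T, hT, hreg⟩ := hd
      by_cases hb : n = 2 ∧ Module.finrank K₀ K = 2
      · obtain ⟨rfl, hd2⟩ := hb
        exact hQ K hcpt K₀ hG hcyc hd2 T hreg ℓ ι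
          (fun π' hL' hT' hK₀' => hS K 2 hcpt hn π' hL' K₀ hG hcyc hK₀ T hT' hreg ℓ ι hK₀') π hL hT
      · exact hH K n hcpt hn K₀ hG hcyc hb T hreg ℓ ι
          (fun π' hL' hT' hK₀' => hS K n hcpt hn π' hL' K₀ hG hcyc hK₀ T hT' hreg ℓ ι hK₀') π hL hT
    · -- (up) a.e.-twisted weak base change up: first conjunct of TRN (= RTT 29150)
      intro K₀ _ _ M _ _ _ n h₀ hM h₁ π₀ χ P hL₀ hχ hrel hπ₀ hn hP hLP ℓ _ ι
      obtain ⟨ρ₀, h0ss, h0c⟩ := hπ₀ hn π₀.2 hL₀ ℓ ι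
      exact hRt K₀ M n h₀ hM h₁ hn π₀ χ ⟨P, hP⟩ hL₀ hχ hLP hrel ℓ ι ρ₀ h0ss h0c
    · -- (ai) automorphic induction down: second conjunct of TRN (= AIT 29151)
      intro K _ _ L _ _ _ m n hL hcpt σ π hm hσ hrel hσS hn hπ hLπ ℓ _ ι
      obtain ⟨r, hrss, hrc⟩ := hσS hm σ.2 hσ ℓ ι
      exact hA K L m n hL hcpt hm hn σ ⟨π, hπ⟩ hσ hLπ hrel ℓ ι r hrss hrc
  · by_cases hh2 : ∀ S : (∀ (K : Type) [Field K] [NumberField K] (n : ℕ) (hcpt : Literature.NumberTheory.Automorphic.isCompact_glFiniteIntegralLevel n K), Literature.NumberTheory.Automorphic.AutomorphicRepData (Literature.NumberTheory.Automorphic.AutomorphyDatum.gl n K hcpt) → Prop), ((∀ (K : Type) [Field K] [NumberField K] (n : ℕ) (hcpt : Literature.NumberTheory.Automorphic.isCompact_glFiniteIntegralLevel n K) (π : Literature.NumberTheory.Automorphic.CuspidalAutomorphicRepData n K hcpt), 0 < n → π.1.IsLAlgebraic → (∃ (K₀ : Type) (_ : Field K₀) (_ : NumberField K₀) (_ : Algebra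 K₀ K), IsGalois K₀ K ∧ IsCyclic (K ≃ₐ[K₀] K) ∧ (NumberField.IsTotallyReal K₀ ∨ NumberField.IsCMField K₀) ∧ ∃ T : Literature.NumberTheory.Automorphic.InfinityType K n, π.1.HasInfinityType T ∧ (Literature.NumberTheory.Automorphic.InfinityType.automorphicInduction K₀ (n * Module.finrank K₀ K) T).IsWeaklyRegular) → S K n hcpt π.1) ∧ (∀ (K₀ : Type) [Field K₀] [NumberField K₀] (M : Type) [Field M] [NumberField M] [Algebra K₀ M] (n : ℕ) (h₀ : Literature.NumberTheory.Automorphic.isCompact_glFiniteIntegralLevel n K₀) (hM : Literature.NumberTheory.Automorphic.isCompact_glFiniteIntegralLevel n M) (h₁ : Literature.NumberTheory.Automorphic.isCompact_glFiniteIntegralLevel 1 M) (π₀ : Literature.NumberTheory.Automorphic.CuspidalAutomorphicRepData n K₀ h₀) (χ : Literature.NumberTheory.Automorphic.AutomorphicRepData (Literature.NumberTheory.Automorphic.AutomorphyDatum.gl 1 M h₁)) (P : Literature.NumberTheory.Automorphic.AutomorphicRepData (Literature.NumberTheory.Automorphic.AutomorphyDatum.gl n M hM)), π₀.1.IsLAlgebraic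 → χ.IsLAlgebraic → (∀ᶠ w : IsDedekindDomain.HeightOneSpectrum (NumberField.RingOfIntegers M) in cofinite, ∀ (u : IsDedekindDomain.HeightOneSpectrum (NumberField.RingOfIntegers K₀)) (α : Multiset ℂ) (c : ℂ), w.asIdeal.under (NumberField.RingOfIntegers K₀) = u.asIdeal → π₀.1.HasSatakeParamAt u α → χ.HasSatakeParamAt w {c} → P.HasSatakeParamAt w ((α.map (· ^ w.asIdeal.inertiaDeg (NumberField.RingOfIntegers K₀))).map (c * ·))) → S K₀ n h₀ π₀.1 → S M n hM P) ∧ (∀ (K : Type) [Field K] [NumberField K] (L : Type) [Field L] [NumberField L] [Algebra K L] (m n : ℕ) (hL : Literature.NumberTheory.Automorphic.isCompact_glFiniteIntegralLevel m L) (hcpt : Literature.NumberTheory.Automorphic.isCompact_glFiniteIntegralLevel n K) (σ : Literature.NumberTheory.Automorphic.CuspidalAutomorphicRepData m L hL) (π : Literature.NumberTheory.Automorphic.AutomorphicRepData (Literature.NumberTheory.Automorphic.AutomorphyDatum.gl n K hcpt)), 0 < m → σ.1.IsLAlgebraic → (∀ᶠ v : IsDedekindDomain.HeightOneSpectrum (NumberField.RingOfIntegers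 K) in cofinite, ∀ β : IsDedekindDomain.HeightOneSpectrum (NumberField.RingOfIntegers L) → Multiset ℂ, (∀ w : IsDedekindDomain.HeightOneSpectrum (NumberField.RingOfIntegers L), w.asIdeal.under (NumberField.RingOfIntegers K) = v.asIdeal → σ.1.HasSatakeParamAt w (β w)) → ∃ α : Multiset ℂ, π.HasSatakeParamAt v α ∧ Literature.NumberTheory.Automorphic.satakePolynomial α = ∏ᶠ w ∈ {w : IsDedekindDomain.HeightOneSpectrum (NumberField.RingOfIntegers L) | w.asIdeal.under (NumberField.RingOfIntegers K) = v.asIdeal}, (Literature.NumberTheory.Automorphic.satakePolynomial (β w)).comp (Polynomial.X ^ w.asIdeal.inertiaDeg (NumberField.RingOfIntegers K))) → S L m hL σ.1 → S K n hcpt π)) → S K n hcpt π.1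
    · -- off HULL₁ but on HULL₂ (the belt): WHS hands a semisimple avatar, IRR makes it irreducible
      obtain ⟨ρ, hss, hc⟩ := hW K n hcpt hn π hL hh hh2 ℓ ι
      exact ⟨ρ, hI K n hcpt hn π hL ℓ ι ρ hss hc, hc⟩
    · -- off HULL₂: REST₃ is W⁺ verbatim there
      exact hR K n hcpt hn π hL hh2 ℓ ι

end Summit.Langlands.Langlands.Theorems
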